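import Mathlib.Topology.Algebra.Group.Basic
import Mathlib.Analysis.Normed.Field.Basic
import Mathlib.Analysis.Complex.Basic
import HarnessLib

/-!
# Weil 1964: continuity of the adelic Weil representation and of theta series (typed skeleton)

A. Weil, *Sur certains groupes d'opérateurs unitaires*, Acta Math. 111 (1964) 143–211
[Weil1964], Chap. III n° 37–41 (pp. 187–194): the adelic metaplectic group `Mp(X)_A` of a finite-dimensional
vector space `X_k` over an A-field `k`, its action `(S, Φ) ↦ SΦ` on the Schwartz–Bruhat space `S(X_A)`, the
canonical lift `r_k : Ps(X)_k → Mp(X)_A` of the rational pseudo-symplectic group, and the theta distribution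
`Θ(S) = Σ_{ξ ∈ X_k} (SΦ)(ξ)`.  WHAT IS REPRODUCED: the STATEMENTS of n° 39 (joint continuity of the action),
n° 41 Théorème 6 (continuity and left `r_k(Ps(X)_k)`-invariance of `Θ`) and n° 41 Lemme 5 (domination on
compact sets of Schwartz–Bruhat functions), as TYPED SKELETONS: each statement is a predicate
`def P (D : …Datum …) : Prop` over a structure of BARE FUNCTIONS on parameter types naming exactly the objects
it quantifies over (the carrier types `Mp(X)_A`, `S(X_A)`, `G`, `S(G)` are parameters; topology / group structure
are instance arguments of the statements that use them); NOTHING IS ASSERTED — a consumer takes `(h : D.P)` for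
its own datum — and the three one-line consequences used downstream are proved.  The quotations were read on the
held OCR text of the Springer PDF (corpus key `paper:doi-10-1007-bf02391012`; printed page = PDF page + 142;
accents restored).

NOT here: the construction of `Mp(X)_A`, of `S(X_A)` and of `r_k` (n° 29–38), the proofs (n° 39–41), the
local theory (Chap. I–II).  The harness tree carries real Schwartz–Bruhat spaces only for adelic vector groups
(`Literature.NumberTheory.Automorphic.piSchwartzBruhat`, without their inductive-limit topology) and no
metaplectic group; when those carriers exist the records below should be re-typed over them.

## References

* [Weil1964] A. Weil, *Sur certains groupes d'opérateurs unitaires*, Acta Math. 111 (1964) 143–211,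
  doi:10.1007/BF02391012 — n° 38 p. 189, n° 39 pp. 189–190, n° 40 p. 190, n° 41 Théorème 6 p. 193, Lemme 5 p. 194.
-/

namespace Literature.NumberTheory.Weil1964

universe u v

/-- **Carriers for [Weil1964, Chap. III, n° 37–41, pp. 187–194]**: `k` an A-field, `X_k` a finite-dimensional
vector space over `k`, `X_A` its adelisation, `S(X_A)` the Schwartz–Bruhat space with its topology (n° 11,
n° 29), `Mp(X)_A` the adelic metaplectic group — a topological group acting on `S(X_A)` by `(S, Φ) ↦ SΦ` — and
`r_k : Ps(X)_k → Mp(X)_A` the canonical lift of the rational pseudo-symplectic group (n° 40, p. 190, PDF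
p0048 L19–21: "on peut donc, au moyen du relèvement `r_Γ` de `B₀(G, Γ)` défini au n° 19, définir ici un
relèvement de `Ps(X)_k` dans `B₀(G)`, et par suite un relèvement de `Ps(X)_k` dans `Mp(X)_A`, qu'on notera
`r_k`"; the continuous local lifts `r_S` of the open sets `Ω_S ⊂ Ps(X)_A` are n° 38, p. 189).  The carrier
types `Mp = Mp(X)_A` and `SX = S(X_A)` are parameters (their topology / group structure are supplied by the
statements that need them); the datum records
* `act S Φ` — `SΦ`;
* `rat` — the subset `{r_k(s) : s ∈ Ps(X)_k} ⊂ Mp(X)_A`;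
* `theta Φ S` — `Θ(S) = Σ_{ξ ∈ X_k} (SΦ)(ξ)` (n° 41).
A hypothesis structure: nothing about these carriers is asserted by the structure itself.
[cite: Weil1964, Chap. III n° 37–41, pp. 187–194] -/
structure WeilThetaDatum (Mp : Type u) (SX : Type v) where
  /-- `(S, Φ) ↦ SΦ` -/
  act : Mp → SX → SX
  /-- `r_k(Ps(X)_k) ⊂ Mp(X)_A` -/
  rat : Set Mp
  /-- `Φ ↦ (S ↦ Θ(S) = Σ_{ξ ∈ X_k} (SΦ)(ξ))` -/
  theta : SX → Mp → ℂ

namespace WeilThetaDatum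

variable {Mp : Type u} {SX : Type v}

/-- **Continuity of the adelic Weil representation (Weil).**  AS PRINTED [Weil1964, Chap. III, n° 39, p. 189
(PDF p0047 L21–23)]: "Comme dans le cas local, on va montrer maintenant que `(S, Φ) → SΦ` détermine une
application continue de `Mp(X)_A × S(X_A)` dans `S(X_A)`" (proved in n° 39–40).
TYPING: joint continuity of `act`; never stronger than print.
[cite: Weil1964, Chap. III n° 39, p. 189] -/
def ActionContinuous [TopologicalSpace Mp] [TopologicalSpace SX] (D : WeilThetaDatum Mp SX) : Prop :=
  Continuous (Function.uncurry D.act)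

/-- **Continuity and automorphy of theta series (Weil).**  AS PRINTED [Weil1964, Chap. III, n° 41,
Théorème 6, p. 193 (PDF p0051 L27–34)]: "Soient `X_k` un espace vectoriel de dimension finie sur `k`, et `Φ`
une fonction appartenant à `S(X_A)`.  Soit `Θ` la fonction sur `Mp(X)_A`, définie, pour tout `S ∈ Mp(X)_A`,
par la formule `Θ(S) = Σ_{ξ ∈ X_k} (SΦ)(ξ)`.  Alors `Θ` est une fonction continue sur `Mp(X)_A`, invariante par
les translations à gauche déterminées par les éléments de `Mp(X)_A` de la forme `r_k(s)`, avec `s ∈ Ps(X)_k`."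
TYPING: conjunct 1 = continuity of `S ↦ Θ(S)` for each `Φ`; conjunct 2 = invariance under left
multiplication by the elements of `rat`.
[cite: Weil1964, Chap. III n° 41 Théorème 6, p. 193] -/
def ThetaContinuousInvariant [TopologicalSpace Mp] [Group Mp] (D : WeilThetaDatum Mp SX) : Prop :=
  (∀ Φ : SX, Continuous (D.theta Φ)) ∧
  ∀ (Φ : SX) (γ : Mp), γ ∈ D.rat → ∀ S : Mp, D.theta Φ (γ * S) = D.theta Φ S

/-- The theta kernel pulled back along any continuous map `s : Y → Mp(X)_A` (e.g. a continuous splitting of a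
dual pair into the metaplectic group) is continuous — immediate from Théorème 6, conjunct 1. [folklore] -/
theorem ThetaContinuousInvariant.theta_comp_continuous [TopologicalSpace Mp] [Group Mp]
    {D : WeilThetaDatum Mp SX} (h : D.ThetaContinuousInvariant) (Φ : SX) {Y : Type*} [TopologicalSpace Y]
    {s : Y → Mp} (hs : Continuous s) : Continuous fun y => D.theta Φ (s y) :=
  (h.1 Φ).comp hs

/-- `Θ` is invariant under left translation by the rational elements `r_k(s)` — Théorème 6, conjunct 2 (so
`Θ` descends to `r_k(Ps(X)_k) \ Mp(X)_A`). [folklore] -/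
theorem ThetaContinuousInvariant.theta_left_invariant [TopologicalSpace Mp] [Group Mp]
    {D : WeilThetaDatum Mp SX} (h : D.ThetaContinuousInvariant) (Φ : SX) {γ : Mp} (hγ : γ ∈ D.rat)
    (S : Mp) : D.theta Φ (γ * S) = D.theta Φ S :=
  h.2 Φ γ hγ S

end WeilThetaDatum

/-- **Carriers for [Weil1964, n° 41 Lemme 5, p. 194]**: `G` a locally compact abelian group, `SG = S(G)` its
Schwartz–Bruhat space (n° 11) — both carrier types are parameters, the topology of `S(G)` is supplied by the
statement — and `eval Φ x = Φ(x)`.  A hypothesis structure (bare carriers).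
[cite: Weil1964, Chap. I n° 11, p. 157] -/
structure SchwartzBruhatDatum (G : Type u) (SG : Type v) where
  /-- `Φ ↦ (x ↦ Φ(x))` -/
  eval : SG → G → ℂ

namespace SchwartzBruhatDatum

variable {G : Type u} {SG : Type v}

/-- **Domination on compact sets of Schwartz–Bruhat functions (Weil).**  AS PRINTED [Weil1964, Chap. III,
n° 41, Lemme 5, p. 194 (PDF p0052 L7–9)]: "Soient `G` un groupe abélien localement compact et `C` une partie
compacte de `S(G)`.  Alors il existe `Φ₀ ∈ S(G)` telle que `|Φ(x)| ≤ Φ₀(x)` quels que soient `Φ ∈ C` et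
`x ∈ G`."
TYPING (WEAKER than print): `|Φ(x)| ≤ |Φ₀(x)|` (print has `Φ₀ ≥ 0` real-valued, so `Φ₀(x) = |Φ₀(x)|`).
[cite: Weil1964, Chap. III n° 41 Lemme 5, p. 194] -/
def CompactDomination [TopologicalSpace SG] (D : SchwartzBruhatDatum G SG) : Prop :=
  ∀ C : Set SG, IsCompact C → ∃ Φ₀ : SG, ∀ Φ ∈ C, ∀ x : G, ‖D.eval Φ x‖ ≤ ‖D.eval Φ₀ x‖

/-- A dominated family is pointwise bounded: under `CompactDomination`, on a compact `C ⊆ S(G)` the values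
`|Φ(x)|`, `Φ ∈ C`, are bounded at each `x` by `|Φ₀(x)|` for ONE `Φ₀` (the form in which Lemme 5 feeds the
term-by-term majorisation of `Σ_ξ (SΦ)(ξ)` in the proof of Théorème 6, p. 194). [folklore] -/
theorem CompactDomination.exists_pointwise_bound [TopologicalSpace SG] {D : SchwartzBruhatDatum G SG}
    (h : D.CompactDomination) {C : Set SG} (hC : IsCompact C) :
    ∃ Φ₀ : SG, ∀ x : G, ∀ Φ ∈ C, ‖D.eval Φ x‖ ≤ ‖D.eval Φ₀ x‖ := by
  obtain ⟨Φ₀, hΦ₀⟩ := h C hC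
  exact ⟨Φ₀, fun x Φ hΦ => hΦ₀ Φ hΦ x⟩

end SchwartzBruhatDatum

end Literature.NumberTheory.Weil1964
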